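import Mathlib
import Summits.Ventures.HodgeRepro2.T5KudlaGaussSum

/-!
# T5EpsilonKudla — the ε-factor identity (T1) with the Gauss sum in Kudla's INTEGRAL form

Kernel support for Tier 5, sub-step N5 / §G, reading residual [R-4] («Tate half»; route/T5-CHECK-G-p7.md §4).
`T5EpsilonTwist.epsShape_mul_epsShape_inv` proves `ε(s, ω, ψ)·ε(1−s, ω⁻¹, ψ) = ω(−1)` for Kudla's printed shape
`ε(s, ω, ψ) = ω(ϖ^{ν+c}) q^{(½−s)(ν+c)} 𝔤(ω|_U)` from the single hypothesis `𝔤(ω|_U)·𝔤(ω⁻¹|_U) = ω(−1)`;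
`T5KudlaGaussSum` proves that hypothesis when `𝔤` is Kudla's integral `q^{c/2}∫_{𝒪^×} ω'(y) ψ(ϖ^{-c}y) dy`
(`kudlaGaussSum`) for `ω'` of conductor exponent exactly `c` and `ψ` of conductor exactly `𝒪` (and the
arbitrary-conductor form `kudlaGaussSumZ`). This file composes the two:

* `epsShape_mul_epsShape_inv_kudla`: (T1) with `G(ω|_U) = kudlaGaussSum … ω' … Ψ`,
  `G(ω⁻¹|_U) = kudlaGaussSum … ω'⁻¹ … Ψ` and `ω(m1) = ω'(−1)`;
* `epsShape_mul_epsShape_inv_kudlaZ`: the same with `kudlaGaussSumZ … Ψ k` (`k = ν + c`).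

The dictionary printed object ↦ kernel object for [R-4] is now: Kudla's `ε` ↦ `epsShape` (its shape, read from
print); Kudla's `𝔤(ω, ψ)` ↦ `kudlaGaussSum(Z)` (his integral, read from print); `ω|_{𝒪^×}` ↦ `ω'`; the conductor
conditions ↦ p4's `conductor (higherUnits ϖ) ω' = c` and «`Ψ` trivial on `ϖ^{c-k}𝒪`, non-trivial on `ϖ^{c-k-1}𝒪`».
-/

namespace Summit.Ventures.HodgeRepro2.T5EpsilonKudla

open MeasureTheory
open Summit.Ventures.HodgeRepro2.T5PrincipalUnitFiltration
open Summit.Ventures.HodgeRepro2.T5ConductorArithmetic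
open Summit.Ventures.HodgeRepro2.T5CharacterDescent
open Summit.Ventures.HodgeRepro2.T5KudlaGaussSum

variable {𝒪 : Type*} [CommRing 𝒪] [IsDomain 𝒪] [IsDiscreteValuationRing 𝒪] {ϖ : 𝒪} {m : ℕ}
  [MeasurableSpace 𝒪] [MeasurableAdd 𝒪] (μ : Measure 𝒪) [μ.IsAddLeftInvariant]
  [IsProbabilityMeasure μ] [Fintype (𝒪 ⧸ Ideal.span ({ϖ ^ (m + 1)} : Set 𝒪))]
  {K : Type*} [Field K] [Algebra 𝒪 K] [IsFractionRing 𝒪 K]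
  {Kx : Type*} [CommGroup Kx]

/-- **(T1) with Kudla's integral.** For `ω' : 𝒪^× → ℂ^×` of conductor exponent exactly `m + 1` and `Ψ` of
conductor exactly `𝒪`, if the Gauss sums in Kudla's shape of `ε` are his integrals `kudlaGaussSum` for `ω'`
and `ω'⁻¹` and `ω(m1) = ω'(−1)`, then `ε(s, ω, ψ)·ε(1−s, ω⁻¹, ψ) = ω(m1)`. -/
theorem epsShape_mul_epsShape_inv_kudla (hI : MeasurableSet (Ideal.span ({ϖ ^ (m + 1)} : Set 𝒪) : Set 𝒪))
    (hϖ : Irreducible ϖ) (U : Subgroup Kx) (ϖ' : Kx) {q : ℂ} (hq : q ≠ 0) (n : ℤ)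
    (c : (Kx →* ℂˣ) → ℕ) (G : (U →* ℂˣ) → ℂ) (s : ℂ) (ω : Kx →* ℂˣ) (m1 : Kx) (hc : c ω⁻¹ = c ω)
    {ω' : 𝒪ˣ →* ℂˣ} (hex : ∃ n, higherUnits ϖ n ≤ ω'.ker) (hω : conductor (higherUnits ϖ) ω' = m + 1)
    (Ψ : AddChar K ℂ) (hΨ : ∀ x : 𝒪, Ψ (algebraMap 𝒪 K x) = 1) {y : 𝒪}
    (hy : Ψ (algebraMap 𝒪 K y / algebraMap 𝒪 K ϖ) ≠ 1)
    (hG : G (ω.restrict U) = kudlaGaussSum μ hϖ ω' (higherUnits_le_ker_of_conductor_eq hex hω) Ψ)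
    (hG' : G (ω⁻¹.restrict U) = kudlaGaussSum μ hϖ ω'⁻¹
      (higherUnits_le_ker_inv (higherUnits_le_ker_of_conductor_eq hex hω)) Ψ)
    (hm : ((ω m1 : ℂˣ) : ℂ) = ((ω' (-1) : ℂˣ) : ℂ)) :
    T5EpsilonTwist.epsShape U ϖ' q n c G s ω * T5EpsilonTwist.epsShape U ϖ' q n c G (1 - s) ω⁻¹
      = ((ω m1 : ℂˣ) : ℂ) :=
  T5EpsilonTwist.epsShape_mul_epsShape_inv U ϖ' hq n c G s ω m1 hc
    (by rw [hG, hG', kudlaGaussSum_mul_kudlaGaussSum_inv μ hI hϖ hex hω Ψ hΨ hy, hm])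

/-- **(T1) with Kudla's integral, `ψ` of arbitrary conductor** (shift `ϖ^{-k}`, `k = ν + c`). -/
theorem epsShape_mul_epsShape_inv_kudlaZ
    (hI : MeasurableSet (Ideal.span ({ϖ ^ (m + 1)} : Set 𝒪) : Set 𝒪))
    (hϖ : Irreducible ϖ) (U : Subgroup Kx) (ϖ' : Kx) {q : ℂ} (hq : q ≠ 0) (n : ℤ)
    (c : (Kx →* ℂˣ) → ℕ) (G : (U →* ℂˣ) → ℂ) (s : ℂ) (ω : Kx →* ℂˣ) (m1 : Kx) (hc : c ω⁻¹ = c ω)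
    {ω' : 𝒪ˣ →* ℂˣ} (hex : ∃ n, higherUnits ϖ n ≤ ω'.ker) (hω : conductor (higherUnits ϖ) ω' = m + 1)
    (Ψ : AddChar K ℂ) (k : ℤ)
    (hΨ : ∀ x : 𝒪, Ψ (algebraMap 𝒪 K x * algebraMap 𝒪 K ϖ ^ ((m + 1 : ℕ) - k)) = 1) {y : 𝒪}
    (hy : Ψ (algebraMap 𝒪 K y * algebraMap 𝒪 K ϖ ^ ((m : ℕ) - k)) ≠ 1)
    (hG : G (ω.restrict U) = kudlaGaussSumZ μ hϖ ω' (higherUnits_le_ker_of_conductor_eq hex hω) Ψ k)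
    (hG' : G (ω⁻¹.restrict U) = kudlaGaussSumZ μ hϖ ω'⁻¹
      (higherUnits_le_ker_inv (higherUnits_le_ker_of_conductor_eq hex hω)) Ψ k)
    (hm : ((ω m1 : ℂˣ) : ℂ) = ((ω' (-1) : ℂˣ) : ℂ)) :
    T5EpsilonTwist.epsShape U ϖ' q n c G s ω * T5EpsilonTwist.epsShape U ϖ' q n c G (1 - s) ω⁻¹
      = ((ω m1 : ℂˣ) : ℂ) :=
  T5EpsilonTwist.epsShape_mul_epsShape_inv U ϖ' hq n c G s ω m1 hc
    (by rw [hG, hG', kudlaGaussSumZ_mul_kudlaGaussSumZ_inv μ hI hϖ hex hω Ψ k hΨ hy, hm])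

end Summit.Ventures.HodgeRepro2.T5EpsilonKudla
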